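import Summits.QuantumAdvantage.AdviceFreeQNC0.AffBells33FibreDichotomy
import Summits.QuantumAdvantage.AdviceFreeQNC0.AffBells35Fibres
import Summits.QuantumAdvantage.AdviceFreeQNC0.AffBells34CoverHard

/-!
# AffBells35 — `PolyLossOfIFM` PROVED (ask P-38a of planner qa-qnc0-p1 g35, ROUND-34 §2.1) and the CORE ASSEMBLY `IFMCore Cw → (NP₁)` (ask P-38a′)

Cell qa-qnc0, route DWalkThree (crux stmt-QuantumAdvantage-22907; working rung (NP₁) `AffBells26.AffBellsPolyLoss3`); prover qn-prover-3 g19.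

THEOREMS.  `polyLossOfIFM : PolyLossOfIFM`, i.e. `ImperfectFibreMass → AffBellsPolyLoss3`; the pointwise form
`affWinCard_le_of_imperfect` (imperfect-fibre mass `≥ 2^{N−1}/N^C` at ONE `(N, β, c)` ⇒ `affWinCard ≤ (1 − N^{−(C+2e)})·2^{N−1}`);
and the CORE ASSEMBLY **`polyLoss_of_ifmCore : IFMCore Cw → AffBellsPolyLoss3`** (P-38a′ = the planner's `polyLoss_of_ocaCorePL`,
HOME exp34/OddCube34.lean §9, with the odd-cube count replaced by imperfect-fibre mass): polylog-coverable strategies lose by the LANDED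
cover hardness `AffBells34.affCoverPolylogHard` (p702069), frame-decomposable ones by the LANDED `AffBells27.affFrameLoss`, and the rest by
`IFMCore` (imperfect mass ⇒ loss by `affWinCard_le_of_imperfect`, or the escape `affWinCard ≤ ¾·2^{N−1}`).  So (NP₁) ⟸ `IFMCore Cw` for any
ONE `Cw`, with no other hypothesis.

PROOF.  The imperfect fibres of g35 (`AffBells35.imperfectFibres`: odd inputs whose kernel-line fibre contains a loser) are literally the
NON-EXACT fibres of g33 (`AffBells33.nonExact`), so `ImperfectFibreMass` is g33's `ExFib` (`exFib_of_ifm`), and g33's FIBRE DICHOTOMY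
(`AffBells33.fibreDichotomy`, landed in `AffBells33FibreDichotomy`: every fibre is exact-win or loses `≥ |F|/(N+1)^6` of itself, via the
sparse product-function uncertainty lemma over `𝔽₄`) turns `ExFib` into (NP₁) (`AffBells33.polyLoss_of_exFib'`).  The planner's suggested
route through DEN-3 (`ParityModTestDensity.parityMod3CosetDensity`) is an alternative proof of the same dichotomy and is not needed.
WHAT THIS IS NOT: no crux closed (`ImperfectFibreMass` itself is the open content, cf. `IFMCore`); separation NOT moved.
-/

noncomputable section

open Classical

namespace Summit.QuantumAdvantage.AdviceFreeQNC0.AffBells35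

open Finset Literature.Computability.QuantumComplexity Literature.Computability.QuantumComplexity.RingHLF
open AffBells23 Fib19 AffBells26 AffBells29

variable {N : ℕ}

/-- imperfect (g35) = non-exact (g33): the two fibre-level loser sets coincide. -/
theorem imperfectFibres_eq_nonExact (β : Fin N → Fin N → ZMod 3) (c : Fin N → ZMod 3) :
    imperfectFibres β c = AffBells33.nonExact β c := by
  ext x
  simp only [imperfectFibres, AffBells33.nonExact, ImperfectAt, AffBells33.ExactFibre, mem_filter, mem_univ, true_and,
    not_forall, exists_prop]

/-- **`ImperfectFibreMass ⇒ ExFib`** (the same statement, `ℝ`-cast versus `ℕ`). -/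
theorem exFib_of_ifm (h : ImperfectFibreMass) : AffBells33.ExFib := by
  obtain ⟨C, n₀, h⟩ := h
  refine ⟨C, n₀, fun N hN β c => ?_⟩
  have h1 := h N hN β c
  rw [imperfectFibres_eq_nonExact] at h1
  exact_mod_cast h1

/-- **P-38a: `PolyLossOfIFM`** — imperfect-fibre mass `≥ 2^{N−1}/N^C` implies the rung (NP₁) `AffBellsPolyLoss3`. -/
theorem polyLossOfIFM : PolyLossOfIFM := fun h => AffBells33.polyLoss_of_exFib' (exFib_of_ifm h)

/-! ### The pointwise form and the core assembly (P-38a′) -/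

/-- **pointwise**: at one `(N, β, c)` with `N ≥ 3`, imperfect-fibre mass `2^{N−1} ≤ N^C·#imperfectFibres` forces
`affWinCard ≤ (1 − 1/N^{C+2e})·2^{N−1}`, `e` the fibre-dichotomy exponent of `AffBells33.nonExact_le_losers'`. -/
theorem affWinCard_le_of_imperfect : ∃ e : ℕ, ∀ (C N : ℕ), 3 ≤ N → ∀ (β : Fin N → Fin N → ZMod 3) (c : Fin N → ZMod 3),
    (2 : ℝ) ^ (N - 1) ≤ (N : ℝ) ^ C * ((imperfectFibres β c).card : ℝ) →
    (affWinCard β c : ℝ) ≤ (1 - 1 / (N : ℝ) ^ (C + 2 * e)) * (2 : ℝ) ^ (N - 1) := by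
  obtain ⟨e, he⟩ := AffBells33.nonExact_le_losers'
  refine ⟨e, fun C N hN β c himp => ?_⟩
  have h2 := he N hN β c
  rw [← imperfectFibres_eq_nonExact] at h2
  have hsum : (affWinCard β c : ℝ) + ((AffBells29.losers β c).card : ℝ) = (2 : ℝ) ^ (N - 1) := by
    exact_mod_cast AffBells29.affWinCard_add_losers (by omega) β c
  have hN1 : (1 : ℝ) ≤ N := by exact_mod_cast (show 1 ≤ N by omega)
  have hNpos : (0 : ℝ) < N := by linarith
  have h2R : ((imperfectFibres β c).card : ℝ) ≤ ((N : ℝ) + 1) ^ e * ((AffBells29.losers β c).card : ℝ) := by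
    exact_mod_cast h2
  have hN12 : ((N : ℝ) + 1) ^ e ≤ (N : ℝ) ^ (2 * e) := by
    have hsq : N + 1 ≤ N ^ 2 := by nlinarith
    have hsqR : ((N : ℝ) + 1) ≤ (N : ℝ) ^ 2 := by exact_mod_cast hsq
    rw [pow_mul]
    exact pow_le_pow_left₀ (by positivity) hsqR e
  have hL : (2 : ℝ) ^ (N - 1) ≤ (N : ℝ) ^ (C + 2 * e) * ((AffBells29.losers β c).card : ℝ) := by
    calc (2 : ℝ) ^ (N - 1) ≤ (N : ℝ) ^ C * ((imperfectFibres β c).card : ℝ) := himp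
      _ ≤ (N : ℝ) ^ C * (((N : ℝ) + 1) ^ e * ((AffBells29.losers β c).card : ℝ)) :=
          mul_le_mul_of_nonneg_left h2R (by positivity)
      _ ≤ (N : ℝ) ^ C * ((N : ℝ) ^ (2 * e) * ((AffBells29.losers β c).card : ℝ)) :=
          mul_le_mul_of_nonneg_left (mul_le_mul_of_nonneg_right hN12 (Nat.cast_nonneg _)) (by positivity)
      _ = (N : ℝ) ^ (C + 2 * e) * ((AffBells29.losers β c).card : ℝ) := by rw [pow_add]; ring
  have hE : (0 : ℝ) < (N : ℝ) ^ (C + 2 * e) := by positivity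
  have hlos : (2 : ℝ) ^ (N - 1) / (N : ℝ) ^ (C + 2 * e) ≤ ((AffBells29.losers β c).card : ℝ) := by
    rw [div_le_iff₀' hE]; exact hL
  have hdiv : (1 - 1 / (N : ℝ) ^ (C + 2 * e)) * (2 : ℝ) ^ (N - 1)
      = (2 : ℝ) ^ (N - 1) - (2 : ℝ) ^ (N - 1) / (N : ℝ) ^ (C + 2 * e) := by ring
  rw [hdiv]
  linarith

/-- arithmetic: `1/N^E ≤ 1 − θ` once `N ≥ M > 1/(1−θ)` and `E ≥ 1` (the planner's `one_div_pow_le_one_sub`, HOME exp34/OddCube34.lean). -/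
theorem one_div_pow_le_one_sub {θ : ℝ} (hθ : θ < 1) {M N : ℕ} (hM : 1 / (1 - θ) < M) (hMN : M ≤ N) {E : ℕ} (hE : 1 ≤ E) :
    1 / (N : ℝ) ^ E ≤ 1 - θ := by
  have h1θ : 0 < 1 - θ := by linarith
  have hMpos : (0 : ℝ) < M := lt_trans (by positivity) hM
  have hMN' : (M : ℝ) ≤ N := by exact_mod_cast hMN
  have hNpos : (0 : ℝ) < N := lt_of_lt_of_le hMpos hMN'
  have hN1 : (1 : ℝ) ≤ N := by
    have : (1 : ℕ) ≤ M := by exact_mod_cast (show (0 : ℝ) < M from hMpos)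
    exact_mod_cast this.trans hMN
  calc 1 / (N : ℝ) ^ E ≤ 1 / (N : ℝ) := by
        apply div_le_div_of_nonneg_left zero_le_one hNpos
        calc (N : ℝ) = (N : ℝ) ^ 1 := (pow_one _).symm
          _ ≤ (N : ℝ) ^ E := pow_le_pow_right₀ hN1 hE
    _ ≤ 1 / (M : ℝ) := div_le_div_of_nonneg_left zero_le_one hMpos hMN'
    _ ≤ 1 - θ := by
        rw [div_le_iff₀ hMpos]
        have := (div_lt_iff₀ h1θ).1 hM
        linarith

/-- **P-38a′ — THE CORE ASSEMBLY: `IFMCore Cw → (NP₁)`**, for any one width exponent `Cw` (polylog-coverable strategies by the landed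
`AffBells34.affCoverPolylogHard`, frame-decomposable ones by the landed `AffBells27.affFrameLoss`, the frame-far non-coverable rest by
`IFMCore`: imperfect-fibre mass or the `¾` escape). -/
theorem polyLoss_of_ifmCore (Cw : ℕ) (h : IFMCore Cw) : AffBellsPolyLoss3 := by
  obtain ⟨θ, hθ, hcov⟩ := AffBells34.affCoverPolylogHard
  obtain ⟨δ₀, hδ₀, r₀, w₀, C, n₀, hn₀⟩ := h
  obtain ⟨n₁, hn₁⟩ := hcov Cw
  obtain ⟨θ', hθ', n₂, hn₂⟩ := AffBells27.affFrameLoss δ₀ hδ₀ r₀ w₀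
  obtain ⟨e, he⟩ := affWinCard_le_of_imperfect
  obtain ⟨M, hM⟩ := exists_nat_gt (1 / (1 - θ))
  obtain ⟨M', hM'⟩ := exists_nat_gt (1 / (1 - θ'))
  refine ⟨C + 2 * e + 1, max (max (max n₀ n₁) (max M 5)) (max n₂ M'), fun N hN β c => ?_⟩
  have hNa : max (max n₀ n₁) (max M 5) ≤ N := le_trans (le_max_left _ _) hN
  have hNb : max n₂ M' ≤ N := le_trans (le_max_right _ _) hN
  have hNn₀ : n₀ ≤ N := le_trans (le_trans (le_max_left _ _) (le_max_left _ _)) hNa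
  have hNn₁ : n₁ ≤ N := le_trans (le_trans (le_max_right _ _) (le_max_left _ _)) hNa
  have hNM : M ≤ N := le_trans (le_trans (le_max_left _ _) (le_max_right _ _)) hNa
  have hN5 : 5 ≤ N := le_trans (le_trans (le_max_right _ _) (le_max_right _ _)) hNa
  have hNn₂ : n₂ ≤ N := le_trans (le_max_left _ _) hNb
  have hNM' : M' ≤ N := le_trans (le_max_right _ _) hNb
  have hN1 : (1 : ℝ) ≤ N := by exact_mod_cast (show 1 ≤ N by omega)
  have h2pos : (0 : ℝ) < (2 : ℝ) ^ (N - 1) := pow_pos (by norm_num) _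
  have step : ∀ {θ₀ : ℝ} {M₀ : ℕ}, θ₀ < 1 → 1 / (1 - θ₀) < M₀ → M₀ ≤ N →
      (affWinCard β c : ℝ) ≤ θ₀ * (2 : ℝ) ^ (N - 1) →
      (affWinCard β c : ℝ) ≤ (1 - 1 / (N : ℝ) ^ (C + 2 * e + 1)) * (2 : ℝ) ^ (N - 1) := by
    intro θ₀ M₀ hθ₀ hM₀ hM₀N hle
    have hθ1 : 1 / (N : ℝ) ^ (C + 2 * e + 1) ≤ 1 - θ₀ := one_div_pow_le_one_sub hθ₀ hM₀ hM₀N (by omega)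
    calc (affWinCard β c : ℝ) ≤ θ₀ * (2 : ℝ) ^ (N - 1) := hle
      _ ≤ (1 - 1 / (N : ℝ) ^ (C + 2 * e + 1)) * (2 : ℝ) ^ (N - 1) := by
          apply mul_le_mul_of_nonneg_right _ h2pos.le
          linarith
  by_cases hcv : ∃ W : Finset (Fin N), 3 * W.card ≤ N ∧ ∀ b, (rowSupp β b \ W).card ≤ (Nat.log 2 N) ^ Cw
  · obtain ⟨W, hW3, hWb⟩ := hcv
    exact step hθ hM hNM (hn₁ N hNn₁ β c W hW3 hWb)
  · push Not at hcv
    by_cases hdec : AffBells27.FrameDecomp δ₀ r₀ w₀ β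
    · exact step hθ' hM' hNM' (hn₂ N hNn₂ β c hdec)
    · rcases hn₀ N hNn₀ β c hdec hcv with himp | hweak
      · have hmain := he C N (by omega) β c himp
        have hmono : 1 / (N : ℝ) ^ (C + 2 * e + 1) ≤ 1 / (N : ℝ) ^ (C + 2 * e) := by
          apply div_le_div_of_nonneg_left zero_le_one (by positivity)
          exact pow_le_pow_right₀ hN1 (by omega)
        calc (affWinCard β c : ℝ) ≤ (1 - 1 / (N : ℝ) ^ (C + 2 * e)) * (2 : ℝ) ^ (N - 1) := hmain
          _ ≤ (1 - 1 / (N : ℝ) ^ (C + 2 * e + 1)) * (2 : ℝ) ^ (N - 1) := by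
              apply mul_le_mul_of_nonneg_right _ h2pos.le
              linarith
      · have h4 : (4 : ℝ) ≤ (N : ℝ) ^ (C + 2 * e + 1) := by
          have h4N : (4 : ℝ) ≤ N := by exact_mod_cast (show 4 ≤ N by omega)
          calc (4 : ℝ) ≤ N := h4N
            _ = (N : ℝ) ^ 1 := (pow_one _).symm
            _ ≤ (N : ℝ) ^ (C + 2 * e + 1) := pow_le_pow_right₀ hN1 (by omega)
        have hq : 1 / (N : ℝ) ^ (C + 2 * e + 1) ≤ 1 / 4 := div_le_div_of_nonneg_left zero_le_one (by norm_num) h4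
        calc (affWinCard β c : ℝ) ≤ (3 / 4) * (2 : ℝ) ^ (N - 1) := by linarith [hweak]
          _ ≤ (1 - 1 / (N : ℝ) ^ (C + 2 * e + 1)) * (2 : ℝ) ^ (N - 1) := by
              apply mul_le_mul_of_nonneg_right _ h2pos.le
              linarith

end Summit.QuantumAdvantage.AdviceFreeQNC0.AffBells35
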